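import Summits.AtomisticToContinuum.BoseEinsteinCondensation.Theorems.BECStronglyRayleighLatticeToPeriodicBridgeMuffinTinDeepWellProfiles
import HarnessLib

/-!
# Route `BECStronglyRayleigh`, crux `LatticeToPeriodicBridge` (stmt-AtomisticToContinuum-9674),
# line `muffin-tin-reward-supermodularity` — S2' decomposition, file 2/5: one-body integrals of the well modes

Second file of the worker decomposition of `Sig.stub_deepWellCondensateLimit` (see `…MuffinTinDeepWellProfiles.lean`).
Elementary real analysis of the explicit profiles of file 1:
* `DeepWell.wellSine`: support `(s, s+ℓ)`, continuity, compact support, `∫ u² = 1` (`integral_wellSine_sq`, via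
  `integral_sin_sq`), `∫ u = √(2/ℓ)·2ℓ/π` (`integral_wellSine`, via `integral_sin`), and pointwise disjointness of
  distinct wells (`wellSine_mul_eq_zero`);
* the comb `DeepWell.blochMode1` and the Bloch limit `DeepWell.blochMode`: `(Σ_j u_j)² = Σ_j u_j²` pointwise,
  `∫ blochMode1² = M`, `∫_ℝ³ blochMode² = 1` (`integral_blochMode_sq`), `∫ blochMode` in closed form, vanishing off
  the cell, continuity;
* the well modes `DeepWell.wellMode`: disjointness, vanishing off the cell, `∫ u_x² = 1`, `∫ u_x` in closed form.
Registered sub-goal: `deepWellOneBody_wellSineNorm` (the normalisation of the clamped Dirichlet sine, global names).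
-/

noncomputable section

namespace Summit.AtomisticToContinuum.BoseEinsteinCondensation.Cruxes.LatticeToPeriodicBridge.MuffinTinRewardSupermodularity

open MeasureTheory Filter Set
open scoped ENNReal NNReal BigOperators Topology ComplexConjugate
open Literature.MathematicalPhysics.QuantumManyBody.BoseGas
open Literature.MathematicalPhysics.QuantumLattice
open Literature.Probability.LatticeModels (TorusSite)
open Summit.AtomisticToContinuum.BoseEinsteinCondensation.Theses
open Summit.AtomisticToContinuum.BoseEinsteinCondensation.Theses.BECStronglyRayleigh
open Summit.AtomisticToContinuum.BoseEinsteinCondensation.Theorems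

namespace DeepWell

variable {ℓ : ℝ}

/-! ## The clamped Dirichlet sine -/

/-- Readout computation helper. [folklore] -/
theorem wellSine_eq_zero_of_le (hℓ : 0 < ℓ) {s t : ℝ} (h : t ≤ s) : wellSine ℓ s t = 0 := by
  unfold wellSine
  have : max 0 (min 1 ((t - s) / ℓ)) = 0 := by
    apply max_eq_left
    exact le_trans (min_le_right _ _) (div_nonpos_of_nonpos_of_nonneg (by linarith) hℓ.le)
  rw [this, mul_zero, Real.sin_zero, mul_zero]

/-- Readout computation helper. [folklore] -/
theorem wellSine_eq_zero_of_ge (hℓ : 0 < ℓ) {s t : ℝ} (h : s + ℓ ≤ t) : wellSine ℓ s t = 0 := by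
  unfold wellSine
  have : max 0 (min 1 ((t - s) / ℓ)) = 1 := by
    have h1 : 1 ≤ (t - s) / ℓ := by rw [le_div_iff₀ hℓ]; linarith
    rw [min_eq_left h1, max_eq_right zero_le_one]
  rw [this, mul_one, Real.sin_pi, mul_zero]

/-- Readout computation helper. [folklore] -/
theorem wellSine_eq_of_mem (hℓ : 0 < ℓ) {s t : ℝ} (h : t ∈ Icc s (s + ℓ)) :
    wellSine ℓ s t = Real.sqrt (2 / ℓ) * Real.sin (Real.pi / ℓ * t - Real.pi * s / ℓ) := by
  unfold wellSine
  have h0 : 0 ≤ (t - s) / ℓ := div_nonneg (by linarith [h.1]) hℓ.le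
  have h1 : (t - s) / ℓ ≤ 1 := by rw [div_le_one hℓ]; linarith [h.2]
  rw [min_eq_right h1, max_eq_right h0]
  congr 2
  field_simp

/-- Readout computation helper. [folklore] -/
theorem wellSine_support (hℓ : 0 < ℓ) {s t : ℝ} (h : wellSine ℓ s t ≠ 0) : s < t ∧ t < s + ℓ := by
  by_contra hc
  rw [not_and_or, not_lt, not_lt] at hc
  rcases hc with hc | hc
  · exact h (wellSine_eq_zero_of_le hℓ hc)
  · exact h (wellSine_eq_zero_of_ge hℓ hc)

/-- Readout computation helper. [folklore] -/
theorem continuous_wellSine (ℓ s : ℝ) : Continuous (wellSine ℓ s) := by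
  unfold wellSine; fun_prop

/-- Readout computation helper. [folklore] -/
theorem integral_wellSine_sq (hℓ : 0 < ℓ) (s : ℝ) : ∫ t, wellSine ℓ s t ^ 2 = 1 := by
  have hvan : ∀ t, t ∉ Ioc s (s + ℓ) → wellSine ℓ s t ^ 2 = 0 := by
    intro t ht
    rw [mem_Ioc, not_and_or, not_lt, not_le] at ht
    rcases ht with ht | ht
    · rw [wellSine_eq_zero_of_le hℓ ht]; simp
    · rw [wellSine_eq_zero_of_ge hℓ ht.le]; simp
  rw [← setIntegral_eq_integral_of_forall_compl_eq_zero hvan,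
    ← intervalIntegral.integral_of_le (by linarith)]
  have heq : EqOn (fun t => wellSine ℓ s t ^ 2)
      (fun t => (2 / ℓ) * ((fun x => Real.sin x ^ 2) (Real.pi / ℓ * t - Real.pi * s / ℓ)))
      (uIcc s (s + ℓ)) := by
    intro t ht
    rw [uIcc_of_le (by linarith)] at ht
    simp only
    rw [wellSine_eq_of_mem hℓ ht, mul_pow, Real.sq_sqrt (by positivity)]
  rw [intervalIntegral.integral_congr heq, intervalIntegral.integral_const_mul,
    intervalIntegral.integral_comp_mul_sub (fun x => Real.sin x ^ 2) (by positivity : Real.pi / ℓ ≠ 0)]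
  have hb1 : Real.pi / ℓ * s - Real.pi * s / ℓ = 0 := by field_simp; ring
  have hb2 : Real.pi / ℓ * (s + ℓ) - Real.pi * s / ℓ = Real.pi := by field_simp; ring
  rw [hb1, hb2, integral_sin_sq]
  simp only [Real.sin_zero, Real.cos_zero, Real.sin_pi, Real.cos_pi, smul_eq_mul]
  field_simp
  ring

/-- Readout computation helper. [folklore] -/
theorem integral_wellSine (hℓ : 0 < ℓ) (s : ℝ) :
    ∫ t, wellSine ℓ s t = Real.sqrt (2 / ℓ) * (2 * ℓ / Real.pi) := by
  have hvan : ∀ t, t ∉ Ioc s (s + ℓ) → wellSine ℓ s t = 0 := by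
    intro t ht
    rw [mem_Ioc, not_and_or, not_lt, not_le] at ht
    rcases ht with ht | ht
    · exact wellSine_eq_zero_of_le hℓ ht
    · exact wellSine_eq_zero_of_ge hℓ ht.le
  rw [← setIntegral_eq_integral_of_forall_compl_eq_zero hvan,
    ← intervalIntegral.integral_of_le (by linarith)]
  have heq : EqOn (fun t => wellSine ℓ s t)
      (fun t => Real.sqrt (2 / ℓ) * ((fun x => Real.sin x) (Real.pi / ℓ * t - Real.pi * s / ℓ)))
      (uIcc s (s + ℓ)) := by
    intro t ht
    rw [uIcc_of_le (by linarith)] at ht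
    simp only
    rw [wellSine_eq_of_mem hℓ ht]
  rw [intervalIntegral.integral_congr heq, intervalIntegral.integral_const_mul,
    intervalIntegral.integral_comp_mul_sub (fun x => Real.sin x) (by positivity : Real.pi / ℓ ≠ 0)]
  have hb1 : Real.pi / ℓ * s - Real.pi * s / ℓ = 0 := by field_simp; ring
  have hb2 : Real.pi / ℓ * (s + ℓ) - Real.pi * s / ℓ = Real.pi := by field_simp; ring
  rw [hb1, hb2, integral_sin]
  simp only [Real.cos_zero, Real.cos_pi, smul_eq_mul]
  field_simp
  ring

/-- Disjoint wells: different offsets `j < j'` (naturals) with `ℓ = (1-w) b`, `s_j = j b + w b`. [folklore] -/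
theorem wellSine_mul_eq_zero {b w : ℝ} (hb : 0 < b) (hw0 : 0 < w) (hw1 : w < 1) {j j' : ℕ} (hjj' : j ≠ j') (t : ℝ) :
    wellSine ((1 - w) * b) ((j : ℝ) * b + w * b) t * wellSine ((1 - w) * b) ((j' : ℝ) * b + w * b) t = 0 := by
  have hℓ : 0 < (1 - w) * b := mul_pos (by linarith) hb
  by_contra h
  rw [mul_eq_zero, not_or] at h
  obtain ⟨h1, h2⟩ := wellSine_support hℓ h.1
  obtain ⟨h3, h4⟩ := wellSine_support hℓ h.2
  rcases lt_or_gt_of_ne hjj' with hlt | hlt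
  · have : (j : ℝ) + 1 ≤ j' := by exact_mod_cast hlt
    nlinarith
  · have : (j' : ℝ) + 1 ≤ j := by exact_mod_cast hlt
    nlinarith

/-- Readout computation helper. [folklore] -/
theorem hasCompactSupport_wellSine (hℓ : 0 < ℓ) (s : ℝ) : HasCompactSupport (wellSine ℓ s) := by
  refine HasCompactSupport.intro (isCompact_Icc (a := s) (b := s + ℓ)) fun t ht => ?_
  rw [mem_Icc, not_and_or, not_le, not_le] at ht
  rcases ht with ht | ht
  · exact wellSine_eq_zero_of_le hℓ ht.le
  · exact wellSine_eq_zero_of_ge hℓ ht.le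

/-- Readout computation helper. [folklore] -/
theorem integrable_wellSine (hℓ : 0 < ℓ) (s : ℝ) : Integrable (wellSine ℓ s) :=
  (continuous_wellSine ℓ s).integrable_of_hasCompactSupport (hasCompactSupport_wellSine hℓ s)

/-- Readout computation helper. [folklore] -/
theorem integrable_wellSine_sq (hℓ : 0 < ℓ) (s : ℝ) : Integrable (fun t => wellSine ℓ s t ^ 2) := by
  refine ((continuous_wellSine ℓ s).pow 2).integrable_of_hasCompactSupport ?_
  refine HasCompactSupport.intro (isCompact_Icc (a := s) (b := s + ℓ)) fun t ht => ?_
  rw [mem_Icc, not_and_or, not_le, not_le] at ht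
  rcases ht with ht | ht
  · simp [wellSine_eq_zero_of_le hℓ ht.le]
  · simp [wellSine_eq_zero_of_ge hℓ ht.le]

/-! ## The comb, the Bloch limit and the well modes -/

variable {M : ℕ} [NeZero M] {L w : ℝ}

/-- Readout computation helper. [folklore] -/
theorem wellSine_wellOff_mul_eq_zero (hL : 0 < L) (hw0 : 0 < w) (hw1 : w < 1) {j j' : ZMod M}
    (hjj' : j ≠ j') (t : ℝ) :
    wellSine ((1 - w) * (L / M)) (wellOff M L w j) t * wellSine ((1 - w) * (L / M)) (wellOff M L w j') t = 0 := by
  have hM : (0 : ℝ) < M := by exact_mod_cast Nat.pos_of_ne_zero (NeZero.ne M)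
  have hb : 0 < L / M := div_pos hL hM
  have hne : j.val ≠ j'.val := fun h => hjj' (ZMod.val_injective M h)
  exact wellSine_mul_eq_zero hb hw0 hw1 hne t

/-- Each well sine of the comb vanishes off `(0, L)`. [folklore] -/
theorem wellSine_wellOff_eq_zero (hL : 0 < L) (hw0 : 0 < w) (hw1 : w < 1) (j : ZMod M) {t : ℝ}
    (ht : t ∉ Ioo 0 L) : wellSine ((1 - w) * (L / M)) (wellOff M L w j) t = 0 := by
  have hM : (0 : ℝ) < M := by exact_mod_cast Nat.pos_of_ne_zero (NeZero.ne M)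
  have hb : 0 < L / M := div_pos hL hM
  have hℓ : 0 < (1 - w) * (L / M) := mul_pos (by linarith) hb
  rw [mem_Ioo, not_and_or, not_lt, not_lt] at ht
  rcases ht with ht | ht
  · refine wellSine_eq_zero_of_le hℓ (le_trans ht ?_)
    unfold wellOff; positivity
  · refine wellSine_eq_zero_of_ge hℓ (le_trans ?_ ht)
    unfold wellOff
    have hj : (j.val : ℝ) + 1 ≤ M := by exact_mod_cast ZMod.val_lt j
    have : (M : ℝ) * (L / M) = L := by field_simp
    nlinarith

/-- Readout computation helper. [folklore] -/
theorem blochMode1_sq (hL : 0 < L) (hw0 : 0 < w) (hw1 : w < 1) (t : ℝ) :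
    blochMode1 M L w t ^ 2 = ∑ j : ZMod M, wellSine ((1 - w) * (L / M)) (wellOff M L w j) t ^ 2 := by
  unfold blochMode1
  rw [sq, Finset.sum_mul_sum]
  refine Finset.sum_congr rfl fun j _ => ?_
  rw [Finset.sum_eq_single j]
  · ring
  · intro j' _ hj'
    exact wellSine_wellOff_mul_eq_zero hL hw0 hw1 (Ne.symm hj') t
  · simp

/-- Readout computation helper. [folklore] -/
theorem integral_blochMode1_sq (hL : 0 < L) (hw0 : 0 < w) (hw1 : w < 1) :
    ∫ t, blochMode1 M L w t ^ 2 = M := by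
  have hM : (0 : ℝ) < M := by exact_mod_cast Nat.pos_of_ne_zero (NeZero.ne M)
  have hℓ : 0 < (1 - w) * (L / M) := mul_pos (by linarith) (div_pos hL hM)
  simp_rw [blochMode1_sq hL hw0 hw1]
  rw [integral_finsetSum _ fun j _ => integrable_wellSine_sq hℓ _]
  simp [integral_wellSine_sq hℓ, ZMod.card]

/-- Readout computation helper. [folklore] -/
theorem integral_blochMode1 (hL : 0 < L) (_hw0 : 0 < w) (hw1 : w < 1) :
    ∫ t, blochMode1 M L w t = M * (Real.sqrt (2 / ((1 - w) * (L / M))) * (2 * ((1 - w) * (L / M)) / Real.pi)) := by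
  have hM : (0 : ℝ) < M := by exact_mod_cast Nat.pos_of_ne_zero (NeZero.ne M)
  have hℓ : 0 < (1 - w) * (L / M) := mul_pos (by linarith) (div_pos hL hM)
  unfold blochMode1
  rw [integral_finsetSum _ fun j _ => integrable_wellSine hℓ _]
  simp [integral_wellSine hℓ, ZMod.card]

/-- Readout computation helper. [folklore] -/
theorem blochMode1_eq_zero (hL : 0 < L) (hw0 : 0 < w) (hw1 : w < 1) {t : ℝ} (ht : t ∉ Ico 0 L) :
    blochMode1 M L w t = 0 := by
  unfold blochMode1
  refine Finset.sum_eq_zero fun j _ => wellSine_wellOff_eq_zero hL hw0 hw1 j fun h => ht ?_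
  exact Ioo_subset_Ico_self h

/-- Readout computation helper. [folklore] -/
theorem blochMode_eq_zero (hL : 0 < L) (hw0 : 0 < w) (hw1 : w < 1) {y : Space} (hy : y ∉ cell L) :
    blochMode M L w y = 0 := by
  unfold blochMode
  simp only [cell, mem_setOf_eq, not_forall] at hy
  obtain ⟨k, hk⟩ := hy
  rw [Finset.prod_eq_zero (Finset.mem_univ k) (blochMode1_eq_zero hL hw0 hw1 hk), mul_zero]

/-- Readout computation helper. [folklore] -/
theorem integral_blochMode_sq (hL : 0 < L) (hw0 : 0 < w) (hw1 : w < 1) :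
    ∫ y, blochMode M L w y ^ 2 = 1 := by
  have hM : (0 : ℝ) < M := by exact_mod_cast Nat.pos_of_ne_zero (NeZero.ne M)
  unfold blochMode
  simp_rw [mul_pow, ← Finset.prod_pow]
  rw [integral_const_mul, integral_space_prod (fun _ t => blochMode1 M L w t ^ 2)]
  simp only [integral_blochMode1_sq hL hw0 hw1, Finset.prod_const, Finset.card_univ, Fintype.card_fin]
  rw [inv_pow, Real.sq_sqrt (by positivity)]
  field_simp

/-- Readout computation helper. [folklore] -/
theorem integral_blochMode (hL : 0 < L) (hw0 : 0 < w) (hw1 : w < 1) :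
    ∫ y, blochMode M L w y = (Real.sqrt ((M : ℝ) ^ 3))⁻¹ *
      (M * (Real.sqrt (2 / ((1 - w) * (L / M))) * (2 * ((1 - w) * (L / M)) / Real.pi))) ^ 3 := by
  unfold blochMode
  rw [integral_const_mul, integral_space_prod (fun _ t => blochMode1 M L w t)]
  simp [integral_blochMode1 hL hw0 hw1]

/-- Readout computation helper. [folklore] -/
theorem continuous_blochMode1 : Continuous (blochMode1 M L w) := by
  unfold blochMode1
  exact continuous_finsetSum _ fun j _ => continuous_wellSine _ _

/-- Readout computation helper. [folklore] -/
theorem continuous_blochMode : Continuous (blochMode M L w) := by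
  unfold blochMode
  exact continuous_const.mul (continuous_finsetProd _ fun k _ =>
    continuous_blochMode1.comp (EuclideanSpace.proj k).continuous)

/-- Distinct wells have disjoint supports: `u_x u_{x'} = 0` pointwise for `x ≠ x'`. [folklore] -/
theorem wellMode_mul_eq_zero (hL : 0 < L) (hw0 : 0 < w) (hw1 : w < 1) {x x' : TorusSite 3 M}
    (hxx' : x ≠ x') (y : Space) : wellMode M L w x y * wellMode M L w x' y = 0 := by
  obtain ⟨k, hk⟩ := Function.ne_iff.mp hxx'
  unfold wellMode
  rw [← Finset.prod_mul_distrib]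
  exact Finset.prod_eq_zero (Finset.mem_univ k) (wellSine_wellOff_mul_eq_zero hL hw0 hw1 hk (y k))

/-- Readout computation helper. [folklore] -/
theorem wellMode_eq_zero (hL : 0 < L) (hw0 : 0 < w) (hw1 : w < 1) (x : TorusSite 3 M) {y : Space}
    (hy : y ∉ cell L) : wellMode M L w x y = 0 := by
  unfold wellMode
  simp only [cell, mem_setOf_eq, not_forall] at hy
  obtain ⟨k, hk⟩ := hy
  refine Finset.prod_eq_zero (Finset.mem_univ k) (wellSine_wellOff_eq_zero hL hw0 hw1 (x k) fun h => hk ?_)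
  exact Ioo_subset_Ico_self h

omit [NeZero M] in
/-- Readout computation helper. [folklore] -/
theorem continuous_wellMode (x : TorusSite 3 M) : Continuous (wellMode M L w x) := by
  unfold wellMode
  exact continuous_finsetProd _ fun k _ => (continuous_wellSine _ _).comp (EuclideanSpace.proj k).continuous

/-- Readout computation helper. [folklore] -/
theorem integral_wellMode_sq (hL : 0 < L) (_hw0 : 0 < w) (hw1 : w < 1) (x : TorusSite 3 M) :
    ∫ y, wellMode M L w x y ^ 2 = 1 := by
  have hM : (0 : ℝ) < M := by exact_mod_cast Nat.pos_of_ne_zero (NeZero.ne M)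
  have hℓ : 0 < (1 - w) * (L / M) := mul_pos (by linarith) (div_pos hL hM)
  unfold wellMode
  simp_rw [← Finset.prod_pow]
  rw [integral_space_prod (fun k t => wellSine ((1 - w) * (L / M)) (wellOff M L w (x k)) t ^ 2)]
  simp [integral_wellSine_sq hℓ]

/-- Readout computation helper. [folklore] -/
theorem integral_wellMode (hL : 0 < L) (_hw0 : 0 < w) (hw1 : w < 1) (x : TorusSite 3 M) :
    ∫ y, wellMode M L w x y = (Real.sqrt (2 / ((1 - w) * (L / M))) * (2 * ((1 - w) * (L / M)) / Real.pi)) ^ 3 := by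
  have hM : (0 : ℝ) < M := by exact_mod_cast Nat.pos_of_ne_zero (NeZero.ne M)
  have hℓ : 0 < (1 - w) * (L / M) := mul_pos (by linarith) (div_pos hL hM)
  unfold wellMode
  rw [integral_space_prod (fun k t => wellSine ((1 - w) * (L / M)) (wellOff M L w (x k)) t)]
  simp [integral_wellSine hℓ]

end DeepWell

/-! ## The registered sub-goal of this file -/

/-- **Registered sub-goal `deepWellOneBody_wellSineNorm`** (S2' decomposition, file 2/5): the clamped Dirichlet
sine `√(2/ℓ) sin(π·clamp((t-s)/ℓ))` is `L²`-normalised (`DeepWell.integral_wellSine_sq`, global names). [folklore] -/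
theorem deepWellOneBody_wellSineNorm :
    ∀ ℓ s : ℝ, 0 < ℓ → MeasureTheory.integral MeasureTheory.volume (fun t : ℝ => (Real.sqrt (2 / ℓ) * Real.sin (Real.pi * max 0 (min 1 ((t - s) / ℓ)))) ^ 2) = 1 :=
  fun _ s hℓ => DeepWell.integral_wellSine_sq hℓ s

end Summit.AtomisticToContinuum.BoseEinsteinCondensation.Cruxes.LatticeToPeriodicBridge.MuffinTinRewardSupermodularity

end
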